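import Mathlib
import Literature.NumberTheory.Automorphic.GreenLevelThreeEichlerIntegral
import Literature.NumberTheory.ModularForms.EisensteinLevelThreeHypergeometric
import HarnessLib

/-!
# Zhou 2015, Remark 9 (iv)a: `G₂^{Γ₀(3)}((3+i√3)/6, i/√3) = −(2π/(3√3)) ∫₀¹ P_{−1/3}(ξ)² dξ`

[topic NumberTheory/Automorphic]

Support file for `Literature.NumberTheory.Automorphic.Zhou2015_legendreP_sq_integral`: the level-three
Green's-function conjunct, in the tree's normalisation `higherGreen 3 2 1 = 2·G₂^{ℌ/Γ̄₀(3)}`: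
`higherGreen 3 2 1 cmLevelThree cmLevelThree' = −(4π/(3√3)) ∫₀¹ P_{−1/3}(ξ)² dξ`, assembled from the
Eichler-integral construction of `G₂^{Γ₀(3)}(·, (3+i√3)/6)` (`GreenLevelThreeEichlerIntegral`) and the
two real-axis inputs of `EisensteinLevelThreeHypergeometric` (`f₃(it) ∈ ℝ` and
`∫_{t>1/√3} f₃(it) dt = (108π)⁻¹ ∫₀¹ P_{−1/3}²`, resting on Ramanujan's cubic signature identity
`(3E₂(3τ) − E₂(τ))/2 = P_{−1/3}(ξ)²` on the imaginary axis).

## References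

* Y. Zhou, *Kontsevich–Zagier integrals for automorphic Green's functions. I*, Ramanujan J. 38
  (2015), Remark 9, eq. (G2_Hecke3_spec_val) (arXiv p. 19). [cite: Zhou2015, Remark 9]
-/

noncomputable section

open Real MeasureTheory intervalIntegral

namespace Literature.NumberTheory.Automorphic

open Literature.NumberTheory.ModularForms (fThree_axisPt_real integral_fThree_axis)

/-- **Zhou 2015, Remark 9, level three**: `higherGreen 3 2 1 ((3+i√3)/6) (i/√3) = −(4π/(3√3)) ∫₀¹ P_{−1/3}(ξ)² dξ`,
i.e. `G₂^{ℌ/Γ̄₀(3)}((3+i√3)/6, i/√3) = −(2π/(3√3)) ∫₀¹ [P_{−1/3}(ξ)]² dξ`. [cite: Zhou2015, Remark 9, eq. (G2_Hecke3_spec_val) (arXiv p. 19)] -/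
theorem higherGreen_three_cmLevelThree_cmLevelThree' :
    higherGreen 3 2 1 cmLevelThree cmLevelThree' =
      -(4 * π / (3 * √3)) * ∫ ξ in (0 : ℝ)..1, legendreP (-1 / 3) ξ ^ 2 :=
  GreenThree.higherGreen_cmLevelThree_of_axis fThree_axisPt_real integral_fThree_axis

end Literature.NumberTheory.Automorphic

end
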